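import Summits.BirchSwinnertonDyer.BirchSwinnertonDyer.Theorems.PrintCf2RamifiedOffTYZTwoPrimesByName
import Summits.BirchSwinnertonDyer.BirchSwinnertonDyer.Theorems.PrintCf2RamifiedOffTYZBlockFreeStructure
import HarnessLib

/-!
# C⁺ ON THE WHOLE SECTOR R2 IS ONE EXPLICIT CONDITION ON (the descent class of the generator, the depth of the GENUS PERIOD `Z(lq)`) —
# BY NAME, no `ρ`, no parity, no display-shaped hypothesis (crux stmt-BirchSwinnertonDyer-20509 `RamifiedOffTYZOfFacts`, line `offtyz-v7`, LEAD g26, cycle 27, part 4)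

HONEST FRAMING (cell `bsd-print-cf2`, route `PrintCf2`; `--supports stmt-BirchSwinnertonDyer-20509`; theorems only, `def`-free, no `sorry`).
BSD is not proved by any of this; no class is closed by this file; item 23431 (C⁺) and crux 20509 stay OPEN.

g18's block-free structure theorem (`BlockFreeStructure.levelTwo_iff_depth_genusPoint_blockFree`, fact-free beyond GZK + displays): for square-free
block-free `n ≡ 7 (mod 8)` with `ord_{s=1} L(E_n,s) = 1` and ANY generator `h = (X, Y)` of `A_n(ℚ)` modulo torsion, the conclusion of C⁺ at `n` holds
iff EITHER `X ∈ 2ℚ^{×2}` (invisible) and TYZ's point `P(n)` has depth exactly one, OR `X ∉ 2ℚ^{×2}` and `P(n)` has depth zero.  Parts 1–3 of this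
cycle (p787913, p788254, p788929) turn every statement about `P(lq)` into one about the genus PERIOD `Z(lq)` BY NAME on the two-prime sector
(`[P] = [Z]` always; at depth two `P ~ Z`, or `P ~ Z − α_q` exactly when the digit `δ(l) = [ord_{s=1} L(E_l,s) = 0 ∧ #Sel₄(E_l) = 2⁴]` is on).
THIS FILE composes them:

* ★★★★ `levelTwo_iff_genusPeriod_R2` — granted conjuncts 1, 2, 4, 5 of 𝔅_ram; primes `l ≡ 1`, `q ≡ 7 (mod 8)`, `n = lq`, `ord_{s=1} L(E_n, s) = 1`;
  a display package `D` (`Printed`, CM-point layer, Thm 3.5 at blocks); ANY generator `h = (X, Y)` of `A_n(ℚ)` modulo torsion; `¬δ(l)`.  Then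
  **C⁺ at `lq` ⟺ (`X ∈ 2ℚ^{×2}` ∧ `Z(lq) ∈ 2A + tors` ∧ `Z(lq) ∉ 4A + tors`) ∨ (`X ∉ 2ℚ^{×2}` ∧ `Z(lq) ∉ 2A + tors`)** — «depth `Z(lq)` = `[X ∈ 2ℚ^{×2}]`».
* `levelTwo_iff_genusPeriod_R2_delta` — the same on the `δ(l)` rows, with `Z(lq) ∉ 4A + tors` replaced by `Z(lq) − α_q ∉ 4A + tors` for every
  generator `α_q` of the free part of `A(K_q)⁻`.
* `levelTwo_iff_genusPeriod_not_twoDivisible_of_visible` — the visible branch alone (both digits): `X ∉ 2ℚ^{×2}` ⟹ (C⁺ ⟺ `Z(lq) ∉ 2A + tors`).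
* `…_of_bundle` — 𝔅_ram VERBATIM + the one display fact `tyz_genusPointBlockData`.

NO hypothesis on `(l/q)`, `#Sel₂`, `#Sel₄(E_{lq})`, `ρ`, or the partner is needed for these EQUIVALENCES (they enter only when one asks whether C⁺'s
own hypotheses hold).  What stays OPEN, isolated: the law «depth_{A(L_{lq}(i))/tors} Z(lq) = [X(h) ∈ 2ℚ^{×2}]» on the jump-one rows (typed:
`Cruxes/RamifiedOffTYZOfFacts/Lines/offtyz_v7_ByName.lean`), a statement about CM values of level-32 modular units; no print decides it.

References: [cite: TianYuanZhang2017, §1 (p0002 L101–L110), §3.1 (p0011 L27–L36, L53–L73), Thm. 3.5 (p0011 L94–L100), Lemma 3.18, Thm. 1.2];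
[cite: BurungaleFlach2024, Thm 1.1 / Cor. 3]; [cite: KoblitzECMF1993, Ch. II §5, Theorem (p. 84)]; [cite: Darmon2004, Thm. 3.22];
[cite: SilvermanAEC2009, Prop. X.1.4, Thm. X.4.2, Prop. X.4.9]; tree: g18 `…BlockFreeStructure`, this cycle's parts 1–3.
-/

noncomputable section

open scoped Classical

open WeierstrassCurve WeierstrassCurve.Affine WeierstrassCurve.Affine.Point
  Literature.NumberTheory.EllipticCurves Literature.NumberTheory.EllipticCurves.Rank1Residual
  Summit.BirchSwinnertonDyer.Rank1Residual
  Literature.NumberTheory.EllipticCurves.TianYuanZhang2017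
  Literature.NumberTheory.EllipticCurves.TianYuanZhang2017.W2
  Summit.BirchSwinnertonDyer.PrintCf2.RankZeroDigitDepthTwo
  Summit.BirchSwinnertonDyer.PrintCf2.PrimeBlockDigits
  Summit.BirchSwinnertonDyer.PrintCf2.TwoPrimesByName

set_option autoImplicit false

namespace Summit.BirchSwinnertonDyer.PrintCf2.GenusPeriodR2

variable {n : ℕ}

/-! ## §1 Depth two of `P(lq)` versus `Z(lq)`, by the digit `δ(l)` -/

/-- **`¬δ(l)` ⟹ (`P(lq) ∈ 4A + tors ⟺ Z(lq) ∈ 4A + tors`)**, by name (conjuncts 2, 4, 5 + displays): either `ord L(E_l) ≥ 2` and `P = Z`, or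
`ord L(E_l) = 0`, `#Sel₄(E_l) ≠ 2⁴` and `4 ∣ 𝓛(l)`. [cite: TianYuanZhang2017, §3.1, Thm. 3.5, §1 (1.1)] [cite: BurungaleFlach2024, Thm 1.1 / Cor. 3] -/
theorem fourDivisible_genusPoint_iff_genusPeriod_of_not_delta (hGZK : rank_eq_analyticRank_of_analyticRank_le_one)
    (hmod : WeierstrassCurve.hasEntireLFunction_rat) (hCM0 : bsdTriple_of_hasCM_of_L_one_ne_zero) (h12 : thm12_parity_of_scriptL')
    {l q : ℕ} (hl : l.Prime) (hq : q.Prime) (hl8 : l % 8 = 1) (hq8 : q % 8 = 5 ∨ q % 8 = 7) (hn : n = l * q)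
    (D : GenusPointData n) (hLs : D.scriptLSpec) (hrec : D.recursion) (heps : D.epsSpec) (hBl : D.Thm35AtBlocks)
    (hδ : ¬ ((congruentNumberCurve l).analyticRank = 0 ∧ Nat.card ((congruentNumberCurve l).selmerGroup 4) = 2 ^ 4)) :
    (∃ y : APoint D.H, IsOfFinAddOrder (D.P n - (4 : ℤ) • y)) ↔ ∃ y : APoint D.H, IsOfFinAddOrder (D.Z n - (4 : ℤ) • y) := by
  obtain ⟨α, hα, -⟩ := exists_generatesFreePart_prime hGZK h12 hq hq8
  obtain ⟨h1, -, h3⟩ := fourDivisible_genusPoint_trichotomy hmod hCM0 h12 hl hq hl8 hq8 hn D hLs hrec heps hBl α hα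
  by_cases h0 : (congruentNumberCurve l).analyticRank = 0
  · exact h1 h0 fun hS => hδ ⟨h0, hS⟩
  · rw [h3 h0]

/-- **`δ(l)` ⟹ (`P(lq) ∈ 4A + tors ⟺ Z(lq) − α_q ∈ 4A + tors`)** for every generator `α_q` of the free part of `A(K_q)⁻`, by name.
[cite: TianYuanZhang2017, §3.1, Thm. 3.5, §1 (1.1)] [cite: BurungaleFlach2024, Thm 1.1 / Cor. 3] -/
theorem fourDivisible_genusPoint_iff_genusPeriod_sub_of_delta
    (hmod : WeierstrassCurve.hasEntireLFunction_rat) (hCM0 : bsdTriple_of_hasCM_of_L_one_ne_zero) (h12 : thm12_parity_of_scriptL')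
    {l q : ℕ} (hl : l.Prime) (hq : q.Prime) (hl8 : l % 8 = 1) (hq8 : q % 8 = 5 ∨ q % 8 = 7) (hn : n = l * q)
    (D : GenusPointData n) (hLs : D.scriptLSpec) (hrec : D.recursion) (heps : D.epsSpec) (hBl : D.Thm35AtBlocks)
    (α : APoint (GenusField q)) (hα : GeneratesFreePart q α)
    (hδ : (congruentNumberCurve l).analyticRank = 0 ∧ Nat.card ((congruentNumberCurve l).selmerGroup 4) = 2 ^ 4) :
    (∃ y : APoint D.H, IsOfFinAddOrder (D.P n - (4 : ℤ) • y)) ↔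
      ∃ y : APoint D.H, IsOfFinAddOrder (D.Z n - Point.map (D.embK q (right_mem_divisors hl hq hn)) α - (4 : ℤ) • y) :=
  (fourDivisible_genusPoint_trichotomy hmod hCM0 h12 hl hq hl8 hq8 hn D hLs hrec heps hBl α hα).2.1 hδ.1 hδ.2

/-! ## §2 C⁺ on R2, every row, BY NAME -/

/-- ★★★★ **C⁺ ON R2 ⟺ «depth `Z(lq)` = [`X(h) ∈ 2ℚ^{×2}`]», the `¬δ(l)` rows.**  Granted conjuncts 1 (GZK), 2 (modularity), 4 (CM rank-zero BSD), 5
(TYZ Thm 1.2′) of 𝔅_ram; primes `l ≡ 1`, `q ≡ 7 (mod 8)`, `n = lq` with `ord_{s=1} L(E_n, s) = 1`; a display package `D` of `n` (`Printed`, the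
CM-point layer, Thm 3.5 at the blocks); ANY generator `h = (X, Y)` of `A_n(ℚ)` modulo torsion; and `¬δ(l)` (`ord_{s=1} L(E_l,s) ≥ 2`, or `= 0` with
`#Sel₄(E_l) ≠ 2⁴`).  Then the conclusion of C⁺ at `n` — `2 ∥ L` for every `L` with `𝓛(lq)² = L²` — holds **iff
(`X = 2s²` for some `s` ∧ `Z(lq) ∈ 2A(ℍ′_n) + tors` ∧ `Z(lq) ∉ 4A(ℍ′_n) + tors`) ∨ (`X ≠ 2s²` for all `s` ∧ `Z(lq) ∉ 2A(ℍ′_n) + tors`).**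
[cite: TianYuanZhang2017, §1 (p0002 L101–L110), §3.1 (p0011 L53–L73), Thm. 3.5 (p0011 L94–L100), Lemma 3.18, Thm. 1.2] [cite: BurungaleFlach2024, Thm 1.1 / Cor. 3]
[cite: KoblitzECMF1993, Ch. II §5, Theorem (p. 84)] [cite: Darmon2004, Thm. 3.22] [cite: SilvermanAEC2009, Prop. X.1.4, Thm. X.4.2, Prop. X.4.9] -/
theorem levelTwo_iff_genusPeriod_R2 (hGZK : rank_eq_analyticRank_of_analyticRank_le_one)
    (hmod : WeierstrassCurve.hasEntireLFunction_rat) (hCM0 : bsdTriple_of_hasCM_of_L_one_ne_zero) (h12 : thm12_parity_of_scriptL')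
    {l q : ℕ} (hl : l.Prime) (hq : q.Prime) (hl8 : l % 8 = 1) (hq8 : q % 8 = 7) (hn : n = l * q)
    (hr : (congruentNumberCurve n).analyticRank = 1)
    (D : GenusPointData n) (hPr : D.Printed) (hC : D.CMPointCompositumPrinted) (hBl : D.Thm35AtBlocks)
    {X Y : ℚ} (h : (Atwo n).toAffine.Nonsingular X Y)
    (hgen : ∀ P : (Atwo n).toAffine.Point, ∃ m : ℤ, IsOfFinAddOrder (P - m • (Point.some X Y h : (Atwo n).toAffine.Point)))
    (hδ : ¬ ((congruentNumberCurve l).analyticRank = 0 ∧ Nat.card ((congruentNumberCurve l).selmerGroup 4) = 2 ^ 4)) :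
    (∀ L : ℤ, IsScriptL n L → (2 : ℤ) ∣ L ∧ ¬ (4 : ℤ) ∣ L) ↔
      (((∃ s : ℚ, X = 2 * s ^ 2) ∧ (∃ y : APoint D.H, IsOfFinAddOrder (D.Z n - (2 : ℤ) • y)) ∧
          ¬ ∃ y : APoint D.H, IsOfFinAddOrder (D.Z n - (4 : ℤ) • y)) ∨
        ((¬ ∃ s : ℚ, X = 2 * s ^ 2) ∧ ¬ ∃ y : APoint D.H, IsOfFinAddOrder (D.Z n - (2 : ℤ) • y))) := by
  obtain ⟨hsq, h7, hnb⟩ := sector_R2 hl hq hl8 hq8 hn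
  have h2 := twoDivisible_genusPoint_iff_genusPeriod hGZK hmod hCM0 h12 hl hq hl8 (Or.inr hq8) hn D hPr.1 hPr.2.2.1 hPr.2.1 hBl
  have h4 := fourDivisible_genusPoint_iff_genusPeriod_of_not_delta hGZK hmod hCM0 h12 hl hq hl8 (Or.inr hq8) hn D hPr.1 hPr.2.2.1 hPr.2.1
    hBl hδ
  rw [BlockFreeStructure.levelTwo_iff_depth_genusPoint_blockFree hGZK hsq h7 hnb hr D hPr hC h hgen, h2, h4]

/-- ★★★ **The `δ(l)` rows** (`ord_{s=1} L(E_l,s) = 0 ∧ #Sel₄(E_l) = 2⁴`; for `l ≡ 1 (mod 8)`: `l = u² + 8v²`, `v` odd, by Wang 2016): same hypotheses,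
for every generator `α_q` of the free part of `A(K_q)⁻`: C⁺ at `lq` **iff (`X = 2s²` ∧ `Z ∈ 2A + tors` ∧ `Z − α_q ∉ 4A + tors`) ∨ (`X ≠ 2s²` ∧ `Z ∉ 2A + tors`).**
[cite: TianYuanZhang2017, §1, §3.1, Thm. 3.5, Lemma 3.18, Thm. 1.2] [cite: BurungaleFlach2024, Thm 1.1 / Cor. 3] [cite: Darmon2004, Thm. 3.22] -/
theorem levelTwo_iff_genusPeriod_R2_delta (hGZK : rank_eq_analyticRank_of_analyticRank_le_one)
    (hmod : WeierstrassCurve.hasEntireLFunction_rat) (hCM0 : bsdTriple_of_hasCM_of_L_one_ne_zero) (h12 : thm12_parity_of_scriptL')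
    {l q : ℕ} (hl : l.Prime) (hq : q.Prime) (hl8 : l % 8 = 1) (hq8 : q % 8 = 7) (hn : n = l * q)
    (hr : (congruentNumberCurve n).analyticRank = 1)
    (D : GenusPointData n) (hPr : D.Printed) (hC : D.CMPointCompositumPrinted) (hBl : D.Thm35AtBlocks)
    {X Y : ℚ} (h : (Atwo n).toAffine.Nonsingular X Y)
    (hgen : ∀ P : (Atwo n).toAffine.Point, ∃ m : ℤ, IsOfFinAddOrder (P - m • (Point.some X Y h : (Atwo n).toAffine.Point)))
    (α : APoint (GenusField q)) (hα : GeneratesFreePart q α)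
    (hδ : (congruentNumberCurve l).analyticRank = 0 ∧ Nat.card ((congruentNumberCurve l).selmerGroup 4) = 2 ^ 4) :
    (∀ L : ℤ, IsScriptL n L → (2 : ℤ) ∣ L ∧ ¬ (4 : ℤ) ∣ L) ↔
      (((∃ s : ℚ, X = 2 * s ^ 2) ∧ (∃ y : APoint D.H, IsOfFinAddOrder (D.Z n - (2 : ℤ) • y)) ∧
          ¬ ∃ y : APoint D.H, IsOfFinAddOrder (D.Z n - Point.map (D.embK q (right_mem_divisors hl hq hn)) α - (4 : ℤ) • y)) ∨
        ((¬ ∃ s : ℚ, X = 2 * s ^ 2) ∧ ¬ ∃ y : APoint D.H, IsOfFinAddOrder (D.Z n - (2 : ℤ) • y))) := by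
  obtain ⟨hsq, h7, hnb⟩ := sector_R2 hl hq hl8 hq8 hn
  have h2 := twoDivisible_genusPoint_iff_genusPeriod hGZK hmod hCM0 h12 hl hq hl8 (Or.inr hq8) hn D hPr.1 hPr.2.2.1 hPr.2.1 hBl
  have h4 := fourDivisible_genusPoint_iff_genusPeriod_sub_of_delta hmod hCM0 h12 hl hq hl8 (Or.inr hq8) hn D hPr.1 hPr.2.2.1 hPr.2.1 hBl
    α hα hδ
  rw [BlockFreeStructure.levelTwo_iff_depth_genusPoint_blockFree hGZK hsq h7 hnb hr D hPr hC h hgen, h2, h4]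

/-- ★★ **The VISIBLE branch, both digits**: same hypotheses without `δ`; if `X ∉ 2ℚ^{×2}` then **C⁺ at `lq` ⟺ `Z(lq) ∉ 2A(ℍ′_n) + tors`** — the
layer-one law GP0-R2 of the workfile, now on the visible `ρ = 0` rows as well as (part 3 §3b) on the partner-trivial ones.
[cite: TianYuanZhang2017, §1, §3.1, Thm. 3.5, Lemma 3.18, Thm. 1.2] [cite: BurungaleFlach2024, Thm 1.1 / Cor. 3] [cite: Darmon2004, Thm. 3.22] -/
theorem levelTwo_iff_genusPeriod_not_twoDivisible_of_visible (hGZK : rank_eq_analyticRank_of_analyticRank_le_one)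
    (hmod : WeierstrassCurve.hasEntireLFunction_rat) (hCM0 : bsdTriple_of_hasCM_of_L_one_ne_zero) (h12 : thm12_parity_of_scriptL')
    {l q : ℕ} (hl : l.Prime) (hq : q.Prime) (hl8 : l % 8 = 1) (hq8 : q % 8 = 7) (hn : n = l * q)
    (hr : (congruentNumberCurve n).analyticRank = 1)
    (D : GenusPointData n) (hPr : D.Printed) (hC : D.CMPointCompositumPrinted) (hBl : D.Thm35AtBlocks)
    {X Y : ℚ} (h : (Atwo n).toAffine.Nonsingular X Y) (hX : ¬ ∃ s : ℚ, X = 2 * s ^ 2)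
    (hgen : ∀ P : (Atwo n).toAffine.Point, ∃ m : ℤ, IsOfFinAddOrder (P - m • (Point.some X Y h : (Atwo n).toAffine.Point))) :
    (∀ L : ℤ, IsScriptL n L → (2 : ℤ) ∣ L ∧ ¬ (4 : ℤ) ∣ L) ↔
      ¬ ∃ y : APoint D.H, IsOfFinAddOrder (D.Z n - (2 : ℤ) • y) := by
  obtain ⟨hsq, h7, hnb⟩ := sector_R2 hl hq hl8 hq8 hn
  rw [BlockFreeStructure.levelTwo_iff_not_twoDivisible_of_X_ne_two_mul_sq hGZK hsq h7 hnb hr D hPr hC h hX hgen,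
    twoDivisible_genusPoint_iff_genusPeriod hGZK hmod hCM0 h12 hl hq hl8 (Or.inr hq8) hn D hPr.1 hPr.2.2.1 hPr.2.1 hBl]

/-! ## §3 With 𝔅_ram VERBATIM and the one display fact -/

/-- ★★★★ **𝔅_ram VERBATIM + `tyz_genusPointBlockData` ⟹ on every R2 row with `ord_{s=1} L(E_{lq},s) = 1` and `¬δ(l)` there is a display package in
which C⁺ at `lq` reads «depth `Z(lq)` = [`X(h) ∈ 2ℚ^{×2}`]» for every generator `h` of `A_{lq}(ℚ)` modulo torsion.**
[cite: TianYuanZhang2017, §1, §3.1, Thm. 3.5, Lemma 3.18, Thm. 1.2] [cite: BurungaleFlach2024, Thm 1.1 / Cor. 3] [cite: KoblitzECMF1993, Ch. II §5]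
[cite: Darmon2004, Thm. 3.22] -/
theorem levelTwo_iff_genusPeriod_R2_of_bundle
    (hB : (Literature.NumberTheory.EllipticCurves.rank_eq_analyticRank_of_analyticRank_le_one ∧ WeierstrassCurve.hasEntireLFunction_rat ∧ WeierstrassCurve.bsdRHS_eq_of_isIsogenous ∧ Literature.NumberTheory.EllipticCurves.bsdTriple_of_hasCM_of_L_one_ne_zero ∧ Literature.NumberTheory.EllipticCurves.TianYuanZhang2017.thm12_parity_of_scriptL' ∧ Literature.NumberTheory.EllipticCurves.Tian2014.thm13_rank_one_and_sha_odd ∧ Literature.NumberTheory.QuadraticFields.RedeiReichardt.redeiReichardt_fourTwoCard_classGroup ∧ Literature.NumberTheory.EllipticCurves.LiLiuTian2024.thm12_bsd_congruentNumberCurve ∧ Literature.NumberTheory.EllipticCurves.Monsky1990.cor515_rank_eq_one_and_card_selmerGroup_two ∧ Literature.NumberTheory.EllipticCurves.HeathBrown1994.monsky_card_selmerGroup_two_even ∧ Literature.NumberTheory.EllipticCurves.Tian2014.tian2014_system_sMinus_genus))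
    (hT : tyz_genusPointBlockData)
    {l q : ℕ} (hl : l.Prime) (hq : q.Prime) (hl8 : l % 8 = 1) (hq8 : q % 8 = 7) (hn : n = l * q)
    (hr : (congruentNumberCurve n).analyticRank = 1)
    (hδ : ¬ ((congruentNumberCurve l).analyticRank = 0 ∧ Nat.card ((congruentNumberCurve l).selmerGroup 4) = 2 ^ 4)) :
    ∃ D : GenusPointData n, D.Printed ∧ D.CMPointCompositumPrinted ∧ D.Thm35AtBlocks ∧
      ∀ {X Y : ℚ} (h : (Atwo n).toAffine.Nonsingular X Y),
        (∀ P : (Atwo n).toAffine.Point, ∃ m : ℤ, IsOfFinAddOrder (P - m • (Point.some X Y h : (Atwo n).toAffine.Point))) →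
          ((∀ L : ℤ, IsScriptL n L → (2 : ℤ) ∣ L ∧ ¬ (4 : ℤ) ∣ L) ↔
            (((∃ s : ℚ, X = 2 * s ^ 2) ∧ (∃ y : APoint D.H, IsOfFinAddOrder (D.Z n - (2 : ℤ) • y)) ∧
                ¬ ∃ y : APoint D.H, IsOfFinAddOrder (D.Z n - (4 : ℤ) • y)) ∨
              ((¬ ∃ s : ℚ, X = 2 * s ^ 2) ∧ ¬ ∃ y : APoint D.H, IsOfFinAddOrder (D.Z n - (2 : ℤ) • y)))) := by
  obtain ⟨hsq, h7, -⟩ := sector_R2 hl hq hl8 hq8 hn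
  obtain ⟨D, hPr, hC, hBl⟩ := hT n hsq (Or.inr (Or.inr h7))
  exact ⟨D, hPr, hC, hBl, fun h hgen =>
    levelTwo_iff_genusPeriod_R2 hB.1 hB.2.1 hB.2.2.2.1 hB.2.2.2.2.1 hl hq hl8 hq8 hn hr D hPr hC hBl h hgen hδ⟩

end Summit.BirchSwinnertonDyer.PrintCf2.GenusPeriodR2

end
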